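import Mathlib
import Summits.KontsevichZagierPeriods.KontsevichZagierPeriods.Theorems.InverseLandauTateFamilyKernelStubLinExact

/-!
# Crux `TateFamilyKernel` (stmt-KontsevichZagierPeriods-9130), line `Sketch`: stub `stub_gpDivision`

Step GP3b (THE ELIMINATION STEP BY EUCLIDEAN DIVISION) of the graph-pencil class
`Q = 1 − ϖ·(u(z₂) + βz₁)` of the lead's skeleton of the crux
`Summit.KontsevichZagierPeriods.KontsevichZagierPeriods.Theses.InverseLandau.TateFamilyKernel`
(variables `X 0 = y` resp. `z₁`, `X 1 = s = z₂`; `u ∈ ℚ[s]`, `0 < β` rational, `P, H ∈ ℚ[X 0, X 1]`).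

Hypotheses: `H(y, s) = ∫_{σ ∈ (s,1)} P((y − u(σ))/β, σ) dσ` for all real `y` and `s ≤ 1` (the
single-branch integral of step GP3a is a polynomial), and `H(u(s) + β, s) = 0` for `s` in a
non-empty open interval `(s₁, 1)` (step GP2). Conclusion: `P = u'(X 1)·∂₀M − β·∂₁M` for some
`M ∈ ℚ[X 0, X 1]`, i.e. `P` lies in the image of the twisted divergence that step GP4 turns into a
Griffiths certificate. The proof is elementary:

1. *Polynomial identities from real ones.* A polynomial `D ∈ ℚ[y, s]` whose real evaluations vanish
   on `ℝ × S` with `S` infinite is zero (`GpDivision.eq_zero_of_aeval_eq_zero`, from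
   `MvPolynomial.funext_set`).
2. *FTC.* With `P̂(y, s) := P((y − u(s))/β, s) ∈ ℚ[y, s]`, differentiating the hypothesis in `s`
   (`intervalIntegral.integral_hasDerivAt_left`, uniqueness of derivatives against
   `LinExact.hasDerivAt_aeval_snd`) gives `∂₁H = −P̂` on `ℝ × (−∞, 1)`, hence in `ℚ[y, s]`.
3. *Infinitely many zeros + factor theorem.* `H(A, s)` with `A := u(s) + β` vanishes on
   `ℝ × (s₁, 1)`, hence is the zero polynomial, and `(y − A) ∣ H − H(A, s)`
   (`GpDivision.X_sub_dvd`, induction on monomials); so `H = (y − A)·G`.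
4. *Differentiate and substitute.* `P̂ = u'(s)·G − (y − A)·∂₁G`; applying the substitution
   `θ : y ↦ u(s) + β·z₁` (which inverts `P ↦ P̂` and sends `y − A` to `β(z₁ − 1)`) and the chain
   rule `LinExact.pderiv_bind₁` yields `P = u'·∂₀M − β·∂₁M` with `M = (z₁ − 1)·θ(G)`.

References: Kontsevich–Zagier 2001, §1.2 (an elementary step of one test class of the period
conjecture). Mathlib and the landed file `…StubLinExact` (`LinExact.pderiv_bind₁`,
`LinExact.hasDerivAt_aeval_snd`) only; no named fact, no new definition. Helpers live in the
sub-namespace `GpDivision`.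
-/

noncomputable section

open MeasureTheory Set MvPolynomial
open Literature.NumberTheory.Transcendental

namespace Summit.KontsevichZagierPeriods.InverseLandau.TateFamilyKernel.Descent

namespace GpDivision

/-- A polynomial `D ∈ ℚ[y, s]` whose real evaluations vanish at every `(y, s)` with `s` in an
infinite set `S ⊆ ℝ` is the zero polynomial (a box with infinite sides, `MvPolynomial.funext_set`,
and injectivity of `ℚ[y, s] → ℝ[y, s]`). [folklore] -/
theorem eq_zero_of_aeval_eq_zero (D : MvPolynomial (Fin 2) ℚ) (S : Set ℝ) (hS : S.Infinite)
    (h : ∀ y : ℝ, ∀ s ∈ S, aeval ![y, s] D = 0) : D = 0 := by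
  apply MvPolynomial.map_injective (algebraMap ℚ ℝ) (algebraMap ℚ ℝ).injective
  rw [map_zero]
  refine MvPolynomial.funext_set (![Set.univ, S] : Fin 2 → Set ℝ) (fun l => ?_) (fun g hg => ?_)
  · fin_cases l
    · exact Set.infinite_univ
    · exact hS
  · rw [MvPolynomial.eval_map, map_zero, ← MvPolynomial.aeval_def]
    have hg1 : g 1 ∈ S := hg 1 (Set.mem_univ _)
    have hv : g = ![g 0, g 1] := by
      funext i
      fin_cases i <;> rfl
    rw [hv]
    exact h (g 0) (g 1) hg1

/-- The scalar polynomial `u(X 1) ∈ ℚ[y, s]` evaluates at `v` to `u(v 1)`. [folklore] -/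
theorem aeval_scalar (u : Polynomial ℚ) (v : Fin 2 → ℝ) :
    aeval v (Polynomial.aeval (X 1 : MvPolynomial (Fin 2) ℚ) u) = Polynomial.aeval (v 1) u := by
  rw [← Polynomial.aeval_algHom_apply, aeval_X]

/-- A substitution fixing `X 1` fixes the scalar polynomial `u(X 1)`. [folklore] -/
theorem bind₁_scalar (u : Polynomial ℚ) (f : Fin 2 → MvPolynomial (Fin 2) ℚ) (hf : f 1 = X 1) :
    bind₁ f (Polynomial.aeval (X 1 : MvPolynomial (Fin 2) ℚ) u) = Polynomial.aeval (X 1) u := by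
  rw [← Polynomial.aeval_algHom_apply, bind₁_X_right, hf]

/-- `∂₁ u(X 1) = u'(X 1)` (chain rule for a derivation applied to `aeval`). [folklore] -/
theorem pderiv_one_scalar (u : Polynomial ℚ) :
    pderiv 1 (Polynomial.aeval (X 1 : MvPolynomial (Fin 2) ℚ) u) =
      Polynomial.aeval (X 1) (Polynomial.derivative u) := by
  rw [Derivation.comp_aeval_eq, pderiv_X_self, smul_eq_mul, mul_one]

/-- `∂₀ u(X 1) = 0`. [folklore] -/
theorem pderiv_zero_scalar (u : Polynomial ℚ) :
    pderiv 0 (Polynomial.aeval (X 1 : MvPolynomial (Fin 2) ℚ) u) = 0 := by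
  rw [Derivation.comp_aeval_eq, pderiv_X_of_ne (by decide : (1 : Fin 2) ≠ 0), smul_zero]

/-- **Factor theorem in `ℚ[s][y]`**: for every `A, H ∈ ℚ[y, s]`, `(y − A)` divides
`H(y, s) − H(A, s)` (on monomials, `y^i − A^i = (y − A)·Σ y^j A^{i−1−j}`). [folklore] -/
theorem X_sub_dvd (A H : MvPolynomial (Fin 2) ℚ) : (X 0 - A) ∣ H - bind₁ ![A, X 1] H := by
  induction H using MvPolynomial.induction_on with
  | C a => simp
  | add p q hp hq =>
    have hpq : p + q - bind₁ ![A, X 1] (p + q) =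
        (p - bind₁ ![A, X 1] p) + (q - bind₁ ![A, X 1] q) := by
      rw [map_add]
      ring
    rw [hpq]
    exact dvd_add hp hq
  | mul_X p i hp =>
    have hpX : p * X i - bind₁ ![A, X 1] (p * X i) =
        (p - bind₁ ![A, X 1] p) * X i + bind₁ ![A, X 1] p * (X i - ![A, X 1] i) := by
      rw [map_mul, bind₁_X_right]
      ring
    rw [hpX]
    refine dvd_add (hp.mul_right _) (dvd_mul_of_dvd_right ?_ _)
    fin_cases i
    · simp
    · simp

/-- **FTC step.** If `H(y, s) = ∫_{(s,1)} F(y, σ) dσ` for all `s ≤ 1` (`F, H ∈ ℚ[y, s]`, `y` fixed),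
then `(∂₁H)(y, s) = −F(y, s)` for every `s < 1` (FTC-1 at the left end point and uniqueness of the
derivative of the polynomial function `s ↦ H(y, s)`). [folklore] -/
theorem aeval_pderiv_eq (H F : MvPolynomial (Fin 2) ℚ) (y : ℝ)
    (hH : ∀ s : ℝ, s ≤ 1 → aeval ![y, s] H = ∫ σ in Ioo s 1, aeval ![y, σ] F) (s : ℝ)
    (hs : s < 1) : aeval ![y, s] (pderiv 1 H) = -aeval ![y, s] F := by
  have hc : Continuous fun σ : ℝ => aeval ![y, σ] F :=
    continuous_iff_continuousAt.2 fun σ => (LinExact.hasDerivAt_aeval_snd F y σ).continuousAt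
  have hg : HasDerivAt (fun s' : ℝ => ∫ σ in s'..1, aeval ![y, σ] F) (-aeval ![y, s] F) s :=
    intervalIntegral.integral_hasDerivAt_left (hc.intervalIntegrable _ _)
      (hc.stronglyMeasurableAtFilter _ _) hc.continuousAt
  have heq : (fun s' : ℝ => aeval ![y, s'] H) =ᶠ[nhds s]
      fun s' : ℝ => ∫ σ in s'..1, aeval ![y, σ] F := by
    filter_upwards [Iio_mem_nhds hs] with s' hs'
    have hs'1 : s' ≤ 1 := le_of_lt hs'
    rw [hH s' hs'1, intervalIntegral.integral_of_le hs'1, integral_Ioc_eq_integral_Ioo]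
  exact (LinExact.hasDerivAt_aeval_snd H y s).unique (hg.congr_of_eventuallyEq heq)

end GpDivision

open GpDivision in
/-- **Graph-pencil class, the elimination step by Euclidean division** (stub `stub_gpDivision` of
the crux `TateFamilyKernel`, line `Sketch`). If the polynomial `H(y, s) = ∫_s^1 P((y − u(σ))/β, σ) dσ`
(`s ≤ 1`) vanishes at `y = u(s) + β` for all `s` in an interval `(s₁, 1)`, then
`h(s) := H(u(s)+β, s) ∈ ℚ[s]` has infinitely many roots, so `h = 0` and `H = (y − u(s) − β)·G` in
`ℚ[y, s]` (factor theorem in `ℚ[s][y]`); differentiating the integral in `s` (FTC, then a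
polynomial identity) gives `P((y − u(s))/β, s) = u'(s)·G − (y − u(s) − β)·∂_s G`; substituting
`y ↦ u(s) + βz₁` and the chain rule yield `P = u'(s)·∂_{z₁}M − β·∂_s M` with
`M = (z₁ − 1)·G(u(s) + βz₁, s)`. [cite: KontsevichZagier2001, §1.2] -/
theorem stub_gpDivision (u : Polynomial ℚ) (β : ℚ) (P H : MvPolynomial (Fin 2) ℚ) (hβ : 0 < β) (s₁ : ℝ) (hs₁ : s₁ < 1)
    (hH : ∀ y s : ℝ, s ≤ 1 → aeval (![y, s] : Fin 2 → ℝ) H =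
      ∫ σ in Ioo s 1, aeval (![(y - Polynomial.aeval σ u) / β, σ] : Fin 2 → ℝ) P)
    (hzero : ∀ s ∈ Ioo s₁ 1, aeval (![Polynomial.aeval s u + β, s] : Fin 2 → ℝ) H = 0) :
    ∃ M : MvPolynomial (Fin 2) ℚ,
      P = Polynomial.aeval (X 1 : MvPolynomial (Fin 2) ℚ) (Polynomial.derivative u) * pderiv 0 M -
        C β * pderiv 1 M := by
  -- names: `Uu = u(s)`, `Ud = u'(s)`, `A = u(s) + β`, `A' = u(s) + β z₁`, `Ph = P((y − u(s))/β, s)`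
  obtain ⟨Uu, hUu⟩ : ∃ Uu : MvPolynomial (Fin 2) ℚ,
      Uu = Polynomial.aeval (X 1 : MvPolynomial (Fin 2) ℚ) u := ⟨_, rfl⟩
  obtain ⟨Ud, hUd⟩ : ∃ Ud : MvPolynomial (Fin 2) ℚ,
      Ud = Polynomial.aeval (X 1 : MvPolynomial (Fin 2) ℚ) (Polynomial.derivative u) := ⟨_, rfl⟩
  obtain ⟨A, hA⟩ : ∃ A : MvPolynomial (Fin 2) ℚ, A = Uu + C β := ⟨_, rfl⟩
  obtain ⟨A', hA'⟩ : ∃ A' : MvPolynomial (Fin 2) ℚ, A' = Uu + C β * X 0 := ⟨_, rfl⟩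
  obtain ⟨Ph, hPh⟩ : ∃ Ph : MvPolynomial (Fin 2) ℚ,
      Ph = bind₁ ![C β⁻¹ * (X 0 - Uu), X 1] P := ⟨_, rfl⟩
  rw [← hUd]
  have h10 : (1 : Fin 2) ≠ 0 := by decide
  have h01 : (0 : Fin 2) ≠ 1 := by decide
  -- scalar facts
  have heU : ∀ v : Fin 2 → ℝ, aeval v Uu = Polynomial.aeval (v 1) u := fun v => by
    rw [hUu]
    exact aeval_scalar u v
  have hU0 : pderiv 0 Uu = 0 := by rw [hUu, pderiv_zero_scalar]
  have hU1 : pderiv 1 Uu = Ud := by rw [hUu, hUd, pderiv_one_scalar]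
  have hA1 : pderiv 1 A = Ud := by rw [hA, map_add, hU1, pderiv_C, add_zero]
  have hA'0 : pderiv 0 A' = C β := by
    rw [hA', map_add, hU0, pderiv_C_mul, pderiv_X_self, mul_one, zero_add]
  have hA'1 : pderiv 1 A' = Ud := by
    rw [hA', map_add, hU1, pderiv_C_mul, pderiv_X_of_ne h01, mul_zero, add_zero]
  -- STEP 1 (FTC): `∂₁ H = −Ph` in `ℚ[y, s]`
  have hePh : ∀ y σ : ℝ, aeval ![y, σ] Ph = aeval ![(y - Polynomial.aeval σ u) / β, σ] P := by
    intro y σ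
    rw [hPh, aeval_bind₁]
    have hv : (fun i => aeval ![y, σ]
        ((![C β⁻¹ * (X 0 - Uu), X 1] : Fin 2 → MvPolynomial (Fin 2) ℚ) i)) =
        ![(y - Polynomial.aeval σ u) / β, σ] := by
      funext i
      fin_cases i
      · simp only [Fin.zero_eta, Matrix.cons_val_zero, map_mul, map_sub, MvPolynomial.aeval_C,
          aeval_X, heU, Matrix.cons_val_one, Matrix.cons_val_fin_one, eq_ratCast, Rat.cast_inv,
          div_eq_inv_mul]
      · simp
    rw [hv]
  have h1 : pderiv 1 H + Ph = 0 := by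
    refine eq_zero_of_aeval_eq_zero _ (Iio 1) (Set.Iio_infinite 1) fun y s hs => ?_
    rw [map_add, aeval_pderiv_eq H Ph y (fun s' hs' => ?_) s hs, neg_add_cancel]
    simp only [hePh]
    exact hH y s' hs'
  -- STEP 2 (infinitely many zeros): `H(A, s) = 0` in `ℚ[y, s]`
  have h2 : bind₁ ![A, X 1] H = 0 := by
    refine eq_zero_of_aeval_eq_zero _ (Ioo s₁ 1) (Set.Ioo_infinite hs₁) fun y s hs => ?_
    rw [aeval_bind₁]
    have hv : (fun i => aeval ![y, s] ((![A, X 1] : Fin 2 → MvPolynomial (Fin 2) ℚ) i)) =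
        ![Polynomial.aeval s u + β, s] := by
      funext i
      fin_cases i
      · simp [hA, heU]
      · simp
    rw [hv]
    exact hzero s hs
  -- STEP 3 (factor theorem): `H = (y − A)·G`
  have h3 := X_sub_dvd A H
  rw [h2, sub_zero] at h3
  obtain ⟨G, hG⟩ := h3
  -- STEP 4 (differentiate in `s`, substitute `y ↦ u(s) + β z₁`, chain rule)
  have hE : Ph = Ud * G - (X 0 - A) * pderiv 1 G := by
    have h := h1
    rw [hG, pderiv_mul, map_sub, pderiv_X_of_ne h01, hA1] at h
    linear_combination h
  -- the substitution `θ = bind₁ ![A', X 1]`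
  have hθ1 : (![A', X 1] : Fin 2 → MvPolynomial (Fin 2) ℚ) 1 = X 1 := by simp
  have hθU : bind₁ ![A', X 1] Uu = Uu := by rw [hUu, bind₁_scalar u _ hθ1]
  have hθUd : bind₁ ![A', X 1] Ud = Ud := by rw [hUd, bind₁_scalar _ _ hθ1]
  have hθA : bind₁ ![A', X 1] A = A := by rw [hA, map_add, hθU, bind₁_C_right]
  have hθX : bind₁ ![A', X 1] (X 0 : MvPolynomial (Fin 2) ℚ) = A' := by
    rw [bind₁_X_right, Matrix.cons_val_zero]
  have hθP : bind₁ ![A', X 1] Ph = P := by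
    have hfun : (fun i => bind₁ (![A', X 1] : Fin 2 → MvPolynomial (Fin 2) ℚ)
        ((![C β⁻¹ * (X 0 - Uu), X 1] : Fin 2 → MvPolynomial (Fin 2) ℚ) i)) =
        (X : Fin 2 → MvPolynomial (Fin 2) ℚ) := by
      funext i
      fin_cases i
      · simp only [Fin.zero_eta, Matrix.cons_val_zero, map_mul, map_sub, bind₁_C_right, hθX, hθU]
        rw [hA', add_sub_cancel_left, ← mul_assoc, ← C_mul, inv_mul_cancel₀ hβ.ne', C_1, one_mul]
      · simp
    rw [hPh, bind₁_bind₁, hfun, bind₁_X_left, AlgHom.id_apply]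
  -- chain rule for `θ G`
  have hG0 : pderiv 0 (bind₁ ![A', X 1] G) = C β * bind₁ ![A', X 1] (pderiv 0 G) := by
    rw [LinExact.pderiv_bind₁, Fin.sum_univ_two]
    simp only [Matrix.cons_val_zero, Matrix.cons_val_one, Matrix.cons_val_fin_one]
    rw [hA'0, pderiv_X_of_ne h10, zero_mul, add_zero]
  have hG1 : pderiv 1 (bind₁ ![A', X 1] G) =
      Ud * bind₁ ![A', X 1] (pderiv 0 G) + bind₁ ![A', X 1] (pderiv 1 G) := by
    rw [LinExact.pderiv_bind₁, Fin.sum_univ_two]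
    simp only [Matrix.cons_val_zero, Matrix.cons_val_one, Matrix.cons_val_fin_one]
    rw [hA'1, pderiv_X_self, one_mul]
  -- apply `θ` to `hE`
  have hP : P = Ud * bind₁ ![A', X 1] G - (A' - A) * bind₁ ![A', X 1] (pderiv 1 G) := by
    have h := congrArg (bind₁ (![A', X 1] : Fin 2 → MvPolynomial (Fin 2) ℚ)) hE
    rw [hθP, map_sub, map_mul, map_mul, map_sub, hθUd, hθX, hθA] at h
    exact h
  have hAA' : A' - A = C β * (X 0 - 1) := by
    rw [hA, hA']
    ring
  refine ⟨(X 0 - 1) * bind₁ ![A', X 1] G, ?_⟩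
  simp only [pderiv_mul, map_sub, pderiv_X_self, pderiv_X_of_ne h01,
    Derivation.map_one_eq_zero, hG0, hG1]
  linear_combination hP - bind₁ ![A', X 1] (pderiv 1 G) * hAA'
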